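import Literature.MathematicalPhysics.QuantumLattice.HubbardScaleZeroSectorSymbolTime
import Literature.MathematicalPhysics.QuantumLattice.TorusCentredMomentumLines
import Literature.MathematicalPhysics.QuantumLattice.AnisotropicSectors
import Mathlib.Analysis.SpecialFunctions.Trigonometric.Bounds
import HarnessLib

/-!
# Geometry of the scale-`0` shell `|e_K| < e₀` of the frame band: it avoids the zone boundary and the origin

Topic `MathematicalPhysics/QuantumLattice`; the two geometric hypotheses of the space second differences of the padded scale-`0` sector
multiplier (`HubbardScaleZeroSectorSymbolSpace.norm_fwdDiff_two_space_bgmGridSymbol_le`: `hzone` and `hr`) from the shape of the frame band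
`e_K(p) = −2(cos p₀ + cos p₁) − μ − K(p)` (`nambuXiCT`; FST: `E = e + K`), for a chemical potential below half filling (`μ < 0`, the Fermi
curve closes around `Γ`) and a small frame `|K| ≤ κ`:

* `nambuXiCT_eq_centred` (`e_K` through the centred momentum), `nambuXiCT_ge_of_boundary`
  (`|2·val(k_l) − L| ≤ 4`, `8 ≤ L` ⇒ `e_K ≥ 2cos(4π/L) − 2 − μ − κ`) and **`le_abs_nambuXiCT_of_boundary`** (⇒ `e₀ ≤ |e_K|` once
  `e₀ ≤ 2cos(4π/L) − 2 − μ − κ`): the boundary strip is outside the shell;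
* `lt_sq_norm_centred_of_abs_nambuXiCT_lt` (`|e_K| < e₀ ⇒ 4 + μ − κ − e₀ < ‖c⃗(k⃗)‖²`, from `cos x ≥ 1 − x²/2`) and
  **`le_norm_centred_of_abs_nambuXiCT_lt`** (⇒ `r₁ ≤ ‖c⃗(k⃗)‖` for `r₁² ≤ 4 + μ − κ − e₀`): the shell stays away from the origin.

Everything is proved; no definitions, no named facts.

## Sources

J. Feldman, M. Salmhofer, E. Trubowitz, J. Stat. Phys. 84 (1996) 1209–1336, §1 (the band `E = e + K` and its Fermi curve)
[`FeldmanSalmhoferTrubowitz1996`]; G. Benfatto, A. Giuliani, V. Mastropietro, Ann. Henri Poincaré 7 (2006) 809–898, §1 (1.4), §2.5 (2.45)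
[`BenfattoGiulianiMastropietro2006`].
-/

noncomputable section

namespace Literature.MathematicalPhysics.QuantumLattice

open Literature.Probability.LatticeModels Real

variable {L : ℕ}

/-- The centred coordinate has the same cosine as the lattice momentum (they differ by a multiple of `2π`). [folklore] -/
private theorem cos_torusCentredMomentum (k : TorusSite 2 L) (i : Fin 2) :
    Real.cos (torusCentredMomentum L k i) = Real.cos (latticeMomentum L k i) := by
  rw [torusCentredMomentum, ← self_sub_toIocDiv_zsmul, zsmul_eq_mul, Real.cos_sub_int_mul_two_pi]

/-- **The frame band through the centred momentum**: `e_K(k⃗) = −2(cos c₀ + cos c₁) − μ − K(p_k⃗)`, `c⃗ = torusCentredMomentum L k⃗`.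
[cite: BenfattoGiulianiMastropietro2006, §1 (1.4)] -/
theorem nambuXiCT_eq_centred (μ : ℝ) (K : TrigPolyC4v) (k : TorusSite 2 L) :
    nambuXiCT L μ K k = -2 * (Real.cos (torusCentredMomentum L k 0) + Real.cos (torusCentredMomentum L k 1)) - μ -
      K.eval (latticeMomentum L k) := by
  rw [nambuXiCT, torusBand, Fin.sum_univ_two, cos_torusCentredMomentum, cos_torusCentredMomentum]

/-- **On the boundary strip the band is large**: if `|2·val(k_l) − L| ≤ 4` (`8 ≤ L`) and `|K| ≤ κ`, then
`e_K(k⃗) ≥ 2cos(4π/L) − 2 − μ − κ`. [cite: FeldmanSalmhoferTrubowitz1996, §1 Discussion (E = e + K)] -/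
theorem nambuXiCT_ge_of_boundary (hL : 8 ≤ L) {μ κ : ℝ} {K : TrigPolyC4v} (hK : ∀ p, |K.eval p| ≤ κ) (l : Fin 2) (k : TorusSite 2 L)
    (h : |2 * (((k l).val : ℤ)) - L| ≤ 4) : 2 * Real.cos (4 * π / L) - 2 - μ - κ ≤ nambuXiCT L μ K k := by
  have hc := cos_latticeMomentum_le_of_abs_sub_le k l hL h
  have hKp := (abs_le.1 (hK (latticeMomentum L k))).2
  rw [nambuXiCT, torusBand, Fin.sum_univ_two]
  fin_cases l
  · have h1 := Real.cos_le_one (latticeMomentum L k 1)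
    have hc' : Real.cos (latticeMomentum L k 0) ≤ -Real.cos (4 * π / L) := hc
    linarith
  · have h0 := Real.cos_le_one (latticeMomentum L k 0)
    have hc' : Real.cos (latticeMomentum L k 1) ≤ -Real.cos (4 * π / L) := hc
    linarith

/-- **The boundary strip is outside the shell** `|e_K| < e₀` once `e₀ ≤ 2cos(4π/L) − 2 − μ − κ` (true for `μ ≤ −μ₀ < 0`, `κ` small, `L` large):
the hypothesis `hzone` of `norm_fwdDiff_two_space_bgmGridSymbol_le`. [cite: FeldmanSalmhoferTrubowitz1996, §1 Discussion (E = e + K)] -/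
theorem le_abs_nambuXiCT_of_boundary (hL : 8 ≤ L) {μ κ e₀ : ℝ} {K : TrigPolyC4v} (hK : ∀ p, |K.eval p| ≤ κ)
    (he : e₀ ≤ 2 * Real.cos (4 * π / L) - 2 - μ - κ) (l : Fin 2) (k : TorusSite 2 L) (h : |2 * (((k l).val : ℤ)) - L| ≤ 4) :
    e₀ ≤ |nambuXiCT L μ K k| :=
  (he.trans (nambuXiCT_ge_of_boundary hL hK l k h)).trans (le_abs_self _)

/-- **Inside the shell the centred momentum is long**: `|e_K(k⃗)| < e₀` and `|K| ≤ κ` give `4 + μ − κ − e₀ < ‖c⃗(k⃗)‖²`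
(`cos x ≥ 1 − x²/2`). [cite: FeldmanSalmhoferTrubowitz1996, §1 Discussion (E = e + K)] -/
theorem lt_sq_norm_centred_of_abs_nambuXiCT_lt {μ κ e₀ : ℝ} {K : TrigPolyC4v} (hK : ∀ p, |K.eval p| ≤ κ) (k : TorusSite 2 L)
    (h : |nambuXiCT L μ K k| < e₀) : 4 + μ - κ - e₀ < ‖momToComplex (torusCentredMomentum L k)‖ ^ 2 := by
  set c := torusCentredMomentum L k with hc
  have hsq : ‖momToComplex c‖ ^ 2 = c 0 ^ 2 + c 1 ^ 2 := by
    rw [Complex.sq_norm, Complex.normSq_apply, momToComplex_re, momToComplex_im]; ring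
  have h0 := Real.one_sub_sq_div_two_le_cos (x := c 0)
  have h1 := Real.one_sub_sq_div_two_le_cos (x := c 1)
  have hKp := (abs_le.1 (hK (latticeMomentum L k))).1
  have he := (abs_lt.1 h).1
  rw [nambuXiCT_eq_centred, ← hc] at he
  rw [hsq]
  linarith

/-- **The shell stays away from the origin**: `|e_K(k⃗)| < e₀ ⇒ r₁ ≤ ‖c⃗(k⃗)‖` for any `r₁` with `r₁² ≤ 4 + μ − κ − e₀`
(the hypothesis `hr` of `norm_fwdDiff_two_space_bgmGridSymbol_le`). [cite: FeldmanSalmhoferTrubowitz1996, §1 Discussion (E = e + K)] -/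
theorem le_norm_centred_of_abs_nambuXiCT_lt {μ κ e₀ r₁ : ℝ} {K : TrigPolyC4v} (hK : ∀ p, |K.eval p| ≤ κ)
    (hr : r₁ ^ 2 ≤ 4 + μ - κ - e₀) (k : TorusSite 2 L) (h : |nambuXiCT L μ K k| < e₀) :
    r₁ ≤ ‖momToComplex (torusCentredMomentum L k)‖ := by
  have hlt := hr.trans_lt (lt_sq_norm_centred_of_abs_nambuXiCT_lt hK k h)
  exact le_of_lt (lt_of_pow_lt_pow_left₀ 2 (norm_nonneg _) hlt)

end Literature.MathematicalPhysics.QuantumLattice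

end
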